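import Literature.NumberTheory.PAdicHodge.CompletedAlgClosure
import Literature.NumberTheory.GaloisRepresentations.UnramifiedCompletion
import Mathlib.RingTheory.AdicCompletion.RingHom
import HarnessLib

/-!
# The embedding `𝒪̂_{F_nr} → 𝒪_{ℂ_F}` of the completed maximal unramified extension

Let `F` be a non-archimedean local field, `ℂ_F = CompletedAlgClosure F` (completion of `F̄`,
`CompletedAlgClosure`), `𝒪_{F_nr} = maxUnramifiedIntegers F ⊆ F̄` the integers of the maximal
unramified extension and `𝒪̂_{F_nr} = maxUnramifiedCompletion F` its `𝔪`-adic completion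
(`UnramifiedCompletion`; abstractly Mathlib's `AdicCompletion`). This file constructs the
canonical **`Γ_F`-equivariant embedding**

  `ι : 𝒪̂_{F_nr} →+* ℂ_F`  (`maxUnramifiedCompletion.toC`),

extending the inclusion `𝒪_{F_nr} ⊆ F̄ ⊆ ℂ_F`, by the universal property of adic completeness
(Mathlib `IsAdicComplete.liftRingHom`) applied to the closed unit ball

  `𝒪_{ℂ_F} = {x ∈ ℂ_F | ‖x‖ ≤ 1}`  (`integerC F`),

which is `ϖ`-adically complete and separated (`isAdicComplete_integerC`: `(ϖ)^n = {‖x‖ ≤ ‖ϖ‖^n}`,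
`mem_span_pow_iff`; a `ϖ`-adically Cauchy sequence is norm-Cauchy, and `ℂ_F` is complete), and
to the compatible family `𝒪̂_{F_nr} → 𝒪_{F_nr}/𝔪ⁿ → 𝒪_{ℂ_F}/(ϖⁿ)` (`𝔪 = (ϖ)`,
`maximalIdeal_eq_span_uniformizer`). Properties: `ι` extends the inclusion of `𝒪_{F_nr}`
(`toC_algebraMap'`), hence of `𝒪_F` (`toC_algebraMap`), and commutes with `Γ_F`
(`smul_toC`: `σ • ι x = ι (galAut σ x)`, by the uniqueness half of the universal property).
This is the input `ι` of the tree's `PeriodRingData.isAdmissible_of_unramified` for every period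
ring over `ℂ_F` (`B_HT`, later `B_dR`): unramified representations are admissible.

## References

* J.-P. Serre, *Local Fields*, Ch. II §3–§5 (`𝒪̂_{F_nr} = W(k̄) ⊗ 𝒪_F ⊆ 𝒪_{ℂ}`). [SerreLocalFields1979]
* J.-M. Fontaine, Y. Ouyang, *Theory of p-adic Galois representations*, §3.1 (`K̂^{nr} ⊆ C`). [FontaineOuyang2022]
-/

noncomputable section

open ValuativeRel Field UniformSpace IsLocalRing AdicCompletion Filter Topology

namespace Literature.NumberTheory.PAdicHodge

open Literature.NumberTheory.GaloisRepresentations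
open Literature.NumberTheory.GaloisRepresentations.IsNonarchimedeanLocalField

variable (F : Type) [Field F] [ValuativeRel F] [TopologicalSpace F] [IsNonarchimedeanLocalField F]

/-! ### The closed unit ball `𝒪_{ℂ_F}` -/

/-- **`𝒪_{ℂ_F}`**, the closed unit ball of `ℂ_F`, a subring (ultrametric inequality).
[cite: FontaineOuyang2022, §3.1] -/
def integerC : Subring (CompletedAlgClosure F) where
  carrier := {x | ‖x‖ ≤ 1}
  mul_mem' {x y} hx hy := by
    change ‖x * y‖ ≤ 1
    rw [norm_mul]; exact mul_le_one₀ hx (norm_nonneg _) hy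
  one_mem' := by change ‖(1 : CompletedAlgClosure F)‖ ≤ 1; rw [norm_one]
  add_mem' {x y} hx hy := by
    change ‖x + y‖ ≤ 1
    exact (IsUltrametricDist.norm_add_le_max _ _).trans (max_le hx hy)
  zero_mem' := by change ‖(0 : CompletedAlgClosure F)‖ ≤ 1; rw [norm_zero]; exact zero_le_one
  neg_mem' {x} hx := by change ‖-x‖ ≤ 1; rw [norm_neg]; exact hx

variable {F}

/-- Membership in `𝒪_{ℂ_F}`. [folklore] -/
theorem mem_integerC_iff {x : CompletedAlgClosure F} : x ∈ integerC F ↔ ‖x‖ ≤ 1 := Iff.rfl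

/-- Elements of `𝒪_{ℂ_F}` have norm `≤ 1`. [folklore] -/
theorem norm_coe_integerC_le (x : integerC F) : ‖(x : CompletedAlgClosure F)‖ ≤ 1 := x.2

/-- `𝒪_{ℂ_F}` is closed in `ℂ_F`. [folklore] -/
theorem isClosed_integerC : IsClosed (integerC F : Set (CompletedAlgClosure F)) := by
  change IsClosed {x : CompletedAlgClosure F | ‖x‖ ≤ 1}
  exact isClosed_le continuous_norm continuous_const

/-- **`(u)^n = {‖x‖ ≤ ‖u‖^n}`** in `𝒪_{ℂ_F}` for `u ≠ 0`. [folklore] -/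
theorem mem_span_pow_iff {u : integerC F} (hu : (u : CompletedAlgClosure F) ≠ 0) (n : ℕ)
    (x : integerC F) :
    x ∈ Ideal.span {u} ^ n ↔ ‖(x : CompletedAlgClosure F)‖ ≤ ‖(u : CompletedAlgClosure F)‖ ^ n := by
  rw [Ideal.span_singleton_pow, Ideal.mem_span_singleton]
  constructor
  · rintro ⟨y, rfl⟩
    rw [Subring.coe_mul, Subring.coe_pow, norm_mul, norm_pow]
    exact mul_le_of_le_one_right (pow_nonneg (norm_nonneg _) n) y.2
  · intro hx
    have hun : ((u : CompletedAlgClosure F)) ^ n ≠ 0 := pow_ne_zero n hu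
    refine ⟨⟨(x : CompletedAlgClosure F) / (u : CompletedAlgClosure F) ^ n, ?_⟩, ?_⟩
    · rw [mem_integerC_iff, norm_div, norm_pow, div_le_one (by rw [← norm_pow]; exact norm_pos_iff.mpr hun)]
      exact hx
    · apply Subtype.ext
      rw [Subring.coe_mul, Subring.coe_pow]
      change (x : CompletedAlgClosure F) = (u : CompletedAlgClosure F) ^ n * ((x : CompletedAlgClosure F) / (u : CompletedAlgClosure F) ^ n)
      rw [mul_div_cancel₀ _ hun]

/-- `(u)^n • ⊤ = (u)^n` as a submodule of `𝒪_{ℂ_F}`. [folklore] -/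
theorem span_pow_smul_top (u : integerC F) (n : ℕ) :
    ((Ideal.span {u} ^ n) • ⊤ : Submodule (integerC F) (integerC F)) = Ideal.span {u} ^ n := by
  rw [Ideal.smul_eq_mul, Ideal.mul_top]

/-- **`𝒪_{ℂ_F}` is `u`-adically complete and separated** for `0 < ‖u‖ < 1`: a `u`-adically Cauchy
sequence is Cauchy for the norm (`(u)^n = {‖x‖ ≤ ‖u‖^n}`), `ℂ_F` is complete and the unit ball is
closed. [cite: FontaineOuyang2022, §3.1] -/
theorem isAdicComplete_integerC {u : integerC F} (hu0 : (u : CompletedAlgClosure F) ≠ 0)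
    (hu1 : ‖(u : CompletedAlgClosure F)‖ < 1) : IsAdicComplete (Ideal.span {u}) (integerC F) := by
  set r : ℝ := ‖(u : CompletedAlgClosure F)‖ with hr
  have hr0 : 0 < r := norm_pos_iff.mpr hu0
  have hmem : ∀ (n : ℕ) (x : integerC F),
      x ∈ ((Ideal.span {u} ^ n) • ⊤ : Submodule (integerC F) (integerC F)) ↔
        ‖(x : CompletedAlgClosure F)‖ ≤ r ^ n := by
    intro n x; rw [span_pow_smul_top, mem_span_pow_iff hu0]
  haveI : IsHausdorff (Ideal.span {u}) (integerC F) := ⟨fun x hx => ?hausdorff⟩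
  case hausdorff =>
    -- Hausdorff: `‖x‖ ≤ r^n` for all `n` forces `x = 0`
    apply Subtype.ext
    change (x : CompletedAlgClosure F) = 0
    have hle : ∀ n : ℕ, ‖(x : CompletedAlgClosure F)‖ ≤ r ^ n := fun n => by
      have := hx n
      rw [SModEq.zero] at this
      exact (hmem n x).mp this
    have hlim : Tendsto (fun n : ℕ => r ^ n) atTop (𝓝 0) := tendsto_pow_atTop_nhds_zero_of_lt_one hr0.le hu1
    have h0 : ‖(x : CompletedAlgClosure F)‖ ≤ 0 := ge_of_tendsto' hlim hle
    exact norm_le_zero_iff.mp h0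
  haveI : IsPrecomplete (Ideal.span {u}) (integerC F) := ⟨fun f hf => ?prec⟩
  case prec =>
    -- precomplete: the sequence is norm-Cauchy
    have hdiff : ∀ {m n : ℕ}, m ≤ n →
        ‖(f m : CompletedAlgClosure F) - (f n : CompletedAlgClosure F)‖ ≤ r ^ m := by
      intro m n hmn
      have h := hf hmn
      rw [SModEq.sub_mem] at h
      have := (hmem m (f m - f n)).mp h
      exact this
    have hcauchy : CauchySeq fun n => (f n : CompletedAlgClosure F) := by
      refine Metric.cauchySeq_iff'.mpr fun ε hε => ?_
      obtain ⟨N, hN⟩ := ((tendsto_pow_atTop_nhds_zero_of_lt_one hr0.le hu1).eventually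
        (gt_mem_nhds hε)).exists
      refine ⟨N, fun n hn => ?_⟩
      rw [dist_eq_norm, norm_sub_rev]
      exact (hdiff hn).trans_lt hN
    obtain ⟨L, hL⟩ := cauchySeq_tendsto_of_complete hcauchy
    have hLmem : L ∈ integerC F :=
      isClosed_integerC.mem_of_tendsto hL (Eventually.of_forall fun n => (f n).2)
    refine ⟨⟨L, hLmem⟩, fun n => ?_⟩
    rw [SModEq.sub_mem, hmem]
    change ‖(f n : CompletedAlgClosure F) - L‖ ≤ r ^ n
    have hcont : Tendsto (fun k => ‖(f n : CompletedAlgClosure F) - (f k : CompletedAlgClosure F)‖) atTop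
        (𝓝 ‖(f n : CompletedAlgClosure F) - L‖) :=
      ((continuous_norm.comp (continuous_const.sub continuous_id)).tendsto L).comp hL
    exact le_of_tendsto hcont (eventually_atTop.mpr ⟨n, fun k hk => hdiff hk⟩)
  exact IsAdicComplete.mk

/-! ### `F̄ → ℂ_F` on Mathlib's `AlgebraicClosure F` and `𝒪_{F_nr} ⊆ 𝒪_{ℂ_F}` -/

variable (F) in
/-- The inclusion `F̄ = AlgebraicClosure F → ℂ_F` (through the normed synonym). [folklore] -/
def algClosureToC : AlgebraicClosure F →+* CompletedAlgClosure F :=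
  (Completion.coeRingHom : NormedAlgClosure F →+* CompletedAlgClosure F).comp
    (NormedAlgClosure.toAlgClosure (F := F)).symm.toRingHom

/-- Unfolding of `algClosureToC`. [folklore] -/
theorem algClosureToC_apply (x : AlgebraicClosure F) :
    algClosureToC F x = ((NormedAlgClosure.toAlgClosure.symm x : NormedAlgClosure F) : CompletedAlgClosure F) := rfl

/-- `‖x‖_{ℂ_F} = algNorm F x` for `x ∈ F̄`. [folklore] -/
theorem norm_algClosureToC (x : AlgebraicClosure F) : ‖algClosureToC F x‖ = algNorm F x := by
  rw [algClosureToC_apply, Completion.norm_coe, NormedAlgClosure.norm_def]; rfl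

/-- `algClosureToC` is `Γ_F`-equivariant. [folklore] -/
theorem smul_algClosureToC (σ : absoluteGaloisGroup F) (x : AlgebraicClosure F) :
    σ • algClosureToC F x = algClosureToC F (σ • x) := by
  rw [algClosureToC_apply, algClosureToC_apply, CompletedAlgClosure.smul_coe]; rfl

/-- `algClosureToC` on `F`: the algebra map `F → ℂ_F`. [folklore] -/
theorem algClosureToC_algebraMap (a : F) :
    algClosureToC F (algebraMap F (AlgebraicClosure F) a) = algebraMap F (CompletedAlgClosure F) a := rfl

variable (F) in
/-- **`𝒪_{F_nr} → 𝒪_{ℂ_F}`**, the inclusion of the unramified integers into the unit ball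
(`‖b‖ ≤ 1`, tree `algNorm_coe_maxUnramifiedIntegers_le_one`). [cite: SerreLocalFields1979, Ch. II §5] -/
def ofMaxUnramifiedIntegers : maxUnramifiedIntegers F →+* integerC F :=
  ((algClosureToC F).comp (maxUnramifiedIntegers F).toSubring.subtype).codRestrict (integerC F)
    fun b => by
      change ‖algClosureToC F (b : AlgebraicClosure F)‖ ≤ 1
      rw [norm_algClosureToC]; exact algNorm_coe_maxUnramifiedIntegers_le_one b

/-- Unfolding of `ofMaxUnramifiedIntegers` in `ℂ_F`. [folklore] -/
theorem coe_ofMaxUnramifiedIntegers (b : maxUnramifiedIntegers F) :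
    ((ofMaxUnramifiedIntegers F b : integerC F) : CompletedAlgClosure F) = algClosureToC F (b : AlgebraicClosure F) := rfl

/-- The action of `σ ∈ Γ_F` on `𝒪_{ℂ_F}` (restriction of the isometric action on `ℂ_F`). [folklore] -/
def galInt (σ : absoluteGaloisGroup F) : integerC F →+* integerC F :=
  (CompletedAlgClosure.galRingHom σ).restrict (integerC F) (integerC F) fun x hx => by
    rw [mem_integerC_iff] at hx ⊢
    change ‖σ • x‖ ≤ 1
    rwa [CompletedAlgClosure.norm_smul]

/-- Unfolding of `galInt`. [folklore] -/
theorem coe_galInt (σ : absoluteGaloisGroup F) (x : integerC F) :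
    ((galInt σ x : integerC F) : CompletedAlgClosure F) = σ • (x : CompletedAlgClosure F) := rfl

/-- `ofMaxUnramifiedIntegers` is `Γ_F`-equivariant. [folklore] -/
theorem galInt_ofMaxUnramifiedIntegers (σ : absoluteGaloisGroup F) (b : maxUnramifiedIntegers F) :
    galInt σ (ofMaxUnramifiedIntegers F b) = ofMaxUnramifiedIntegers F (σ • b) := by
  apply Subtype.ext
  rw [coe_galInt, coe_ofMaxUnramifiedIntegers, coe_ofMaxUnramifiedIntegers, smul_algClosureToC,
    maxUnramifiedIntegers.coe_smul]

/-- `galInt σ` preserves the norm, hence every `(u)^n`. [folklore] -/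
theorem galInt_mem_span_pow (σ : absoluteGaloisGroup F) {u : integerC F} (hu : (u : CompletedAlgClosure F) ≠ 0)
    (n : ℕ) {x : integerC F} (hx : x ∈ Ideal.span {u} ^ n) : galInt σ x ∈ Ideal.span {u} ^ n := by
  rw [mem_span_pow_iff hu] at hx ⊢
  rwa [coe_galInt, CompletedAlgClosure.norm_smul]

/-! ### The uniformiser and the compatible family -/

section Uniformizer

/-- An element `ϖ ∈ 𝒪_F` as an element of `𝒪_{ℂ_F}`. [folklore] -/
def unifC (ϖ : 𝒪[F]) : integerC F := ofMaxUnramifiedIntegers F (algebraMap 𝒪[F] (maxUnramifiedIntegers F) ϖ)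

/-- `unifC ϖ = ϖ` in `ℂ_F`. [folklore] -/
theorem coe_unifC (ϖ : 𝒪[F]) : ((unifC ϖ : integerC F) : CompletedAlgClosure F) = algebraMap F (CompletedAlgClosure F) (ϖ : F) := by
  rw [unifC, coe_ofMaxUnramifiedIntegers, coe_algebraMap_maxUnramifiedIntegers,
    IsScalarTower.algebraMap_apply 𝒪[F] F (AlgebraicClosure F), algClosureToC_algebraMap]
  rfl

variable {ϖ : 𝒪[F]} (hϖ : Irreducible ϖ)
include hϖ

/-- `ϖ ≠ 0` in `ℂ_F`. [folklore] -/
theorem coe_unifC_ne_zero : ((unifC ϖ : integerC F) : CompletedAlgClosure F) ≠ 0 := by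
  rw [coe_unifC ϖ, map_ne_zero]
  exact_mod_cast hϖ.ne_zero

/-- `‖ϖ‖ < 1` in `ℂ_F`. [folklore] -/
theorem norm_unifC_lt_one : ‖((unifC ϖ : integerC F) : CompletedAlgClosure F)‖ < 1 := by
  rw [coe_unifC ϖ, CompletedAlgClosure.norm_algebraMap]
  exact (norm_lt_one_iff F _).mpr (Valuation.Integer.not_isUnit_iff_valuation_lt_one.mp hϖ.not_isUnit)

/-- `𝒪_{ℂ_F}` is `ϖ`-adically complete. [folklore] -/
theorem isAdicComplete_unifC : IsAdicComplete (Ideal.span {unifC ϖ}) (integerC F) :=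
  isAdicComplete_integerC (coe_unifC_ne_zero hϖ) (norm_unifC_lt_one hϖ)

/-- `𝔪^n ≤ (ϖ)^n` pulled back along `𝒪_{F_nr} → 𝒪_{ℂ_F}` (`𝔪 = (ϖ)`). [folklore] -/
theorem maximalIdeal_pow_le_comap (n : ℕ) :
    maximalIdeal (maxUnramifiedIntegers F) ^ n ≤ (Ideal.span {unifC ϖ} ^ n).comap (ofMaxUnramifiedIntegers F) := by
  rw [maximalIdeal_eq_span_uniformizer hϖ, Ideal.span_singleton_pow, Ideal.span_singleton_pow,
    Ideal.span_le, Set.singleton_subset_iff, SetLike.mem_coe, Ideal.mem_comap, map_pow]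
  exact Ideal.mem_span_singleton_self _

/-- **The compatible family** `𝒪̂_{F_nr} → 𝒪_{F_nr}/𝔪ⁿ → 𝒪_{ℂ_F}/(ϖⁿ)`. [folklore] -/
def fam (n : ℕ) : maxUnramifiedCompletion F →+* integerC F ⧸ Ideal.span {unifC ϖ} ^ n :=
  (Ideal.quotientMap (Ideal.span {unifC ϖ} ^ n) (ofMaxUnramifiedIntegers F) (maximalIdeal_pow_le_comap hϖ n)).comp
    (evalₐ (maximalIdeal (maxUnramifiedIntegers F)) n).toRingHom

/-- Unfolding of `fam`. [folklore] -/
theorem fam_apply (n : ℕ) (x : maxUnramifiedCompletion F) :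
    fam hϖ n x = Ideal.quotientMap (Ideal.span {unifC ϖ} ^ n) (ofMaxUnramifiedIntegers F)
      (maximalIdeal_pow_le_comap hϖ n) (evalₐ (maximalIdeal (maxUnramifiedIntegers F)) n x) := rfl

omit hϖ in
/-- Transition compatibility of the evaluations `evalₐ`. [folklore] -/
theorem factorPow_evalₐ {R : Type*} [CommRing R] (I : Ideal R) {m n : ℕ} (hle : m ≤ n)
    (x : AdicCompletion I R) :
    Ideal.Quotient.factorPow I hle (evalₐ I n x) = evalₐ I m x := by
  have hn : (I ^ n • ⊤ : Ideal R) ≤ I ^ n := by rw [Ideal.smul_eq_mul, Ideal.mul_top]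
  have hm : (I ^ m • ⊤ : Ideal R) ≤ I ^ m := by rw [Ideal.smul_eq_mul, Ideal.mul_top]
  rw [← factor_eval_eq_evalₐ I x hn, ← factor_eval_eq_evalₐ I x hm]
  change Ideal.Quotient.factorPow I hle (Submodule.factor hn (x.val n)) = Submodule.factor hm (x.val m)
  rw [← transitionMap_comp_eval_apply I R hle x]
  generalize x.val n = q
  induction q using Quotient.inductionOn' with
  | h r => rfl

/-- The family `fam` is compatible with the transition maps. [folklore] -/
theorem fam_compat {m n : ℕ} (hle : m ≤ n) :
    (Ideal.Quotient.factorPow (Ideal.span {unifC ϖ}) hle).comp (fam hϖ n) = fam hϖ m := by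
  refine RingHom.ext fun x => ?_
  rw [RingHom.comp_apply, fam_apply, fam_apply, ← factorPow_evalₐ _ hle x]
  generalize evalₐ (maximalIdeal (maxUnramifiedIntegers F)) n x = q
  induction q using Quotient.inductionOn' with
  | h r => rfl

/-! ### The embedding `ι : 𝒪̂_{F_nr} → 𝒪_{ℂ_F} → ℂ_F` -/

/-- **`ι₀ : 𝒪̂_{F_nr} → 𝒪_{ℂ_F}`**, the lift of the compatible family (universal property of the
`ϖ`-adically complete ring `𝒪_{ℂ_F}`, Mathlib `IsAdicComplete.liftRingHom`). [cite: SerreLocalFields1979, Ch. II §5] -/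
def toCInt : maxUnramifiedCompletion F →+* integerC F :=
  haveI := isAdicComplete_unifC hϖ
  IsAdicComplete.liftRingHom (Ideal.span {unifC ϖ}) (fam hϖ) (fun hle => fam_compat hϖ hle)

/-- The defining congruences of `ι₀`: `ι₀ x ≡ fam n x (mod ϖⁿ)`. [folklore] -/
theorem mk_toCInt (n : ℕ) (x : maxUnramifiedCompletion F) :
    Ideal.Quotient.mk (Ideal.span {unifC ϖ} ^ n) (toCInt hϖ x) = fam hϖ n x := by
  haveI := isAdicComplete_unifC hϖ
  exact IsAdicComplete.mk_liftRingHom (Ideal.span {unifC ϖ}) (fam hϖ) (fun hle => fam_compat hϖ hle) n x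

/-- Two elements of `𝒪_{ℂ_F}` congruent modulo every `ϖⁿ` are equal. [folklore] -/
theorem eq_of_forall_mk_eq {x y : integerC F}
    (h : ∀ n, Ideal.Quotient.mk (Ideal.span {unifC ϖ} ^ n) x = Ideal.Quotient.mk (Ideal.span {unifC ϖ} ^ n) y) :
    x = y := by
  haveI := isAdicComplete_unifC hϖ
  rw [← sub_eq_zero]
  refine IsHausdorff.haus (IsAdicComplete.toIsHausdorff (I := Ideal.span {unifC ϖ})) (x - y) fun n => ?_
  rw [SModEq.zero, span_pow_smul_top, ← Ideal.Quotient.eq_zero_iff_mem, map_sub, sub_eq_zero]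
  exact h n

/-- **`ι₀` extends the inclusion `𝒪_{F_nr} ⊆ 𝒪_{ℂ_F}`.** [cite: SerreLocalFields1979, Ch. II §5] -/
theorem toCInt_algebraMap' (b : maxUnramifiedIntegers F) :
    toCInt hϖ (algebraMap (maxUnramifiedIntegers F) (maxUnramifiedCompletion F) b) = ofMaxUnramifiedIntegers F b := by
  refine eq_of_forall_mk_eq hϖ fun n => ?_
  rw [mk_toCInt, fam_apply, AdicCompletion.algebraMap_apply, Algebra.algebraMap_self, RingHom.id_apply,
    evalₐ_of, Ideal.quotientMap_mk]

/-- **`ι₀` is `Γ_F`-equivariant**: `σ(ι₀ x) = ι₀(σ x)` — both sides are lifts of the `σ`-twisted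
family, hence equal by the uniqueness half of the universal property. [cite: SerreLocalFields1979, Ch. II §5] -/
theorem galInt_toCInt (σ : absoluteGaloisGroup F) (x : maxUnramifiedCompletion F) :
    galInt σ (toCInt hϖ x) = toCInt hϖ (maxUnramifiedCompletion.galAut F σ x) := by
  haveI := isAdicComplete_unifC hϖ
  set J : Ideal (integerC F) := Ideal.span {unifC ϖ} with hJ
  -- the induced action on the quotients
  have hle : ∀ n, J ^ n ≤ (J ^ n).comap (galInt σ) := fun n x hx =>
    galInt_mem_span_pow σ (coe_unifC_ne_zero hϖ) n hx
  let gq : (n : ℕ) → (integerC F ⧸ J ^ n →+* integerC F ⧸ J ^ n) := fun n => Ideal.quotientMap (J ^ n) (galInt σ) (hle n)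
  -- the twisted family
  let g : (n : ℕ) → maxUnramifiedCompletion F →+* integerC F ⧸ J ^ n := fun n => (gq n).comp (fam hϖ n)
  have hg : ∀ {m n : ℕ} (hmn : m ≤ n), (Ideal.Quotient.factorPow J hmn).comp (g n) = g m := by
    intro m n hmn
    refine RingHom.ext fun y => ?_
    change Ideal.Quotient.factorPow J hmn (gq n (fam hϖ n y)) = gq m (fam hϖ m y)
    rw [← fam_compat hϖ hmn, RingHom.comp_apply]
    generalize fam hϖ n y = q
    induction q using Quotient.inductionOn' with
    | h r => rfl
  -- both sides are `liftRingHom J g hg`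
  have h1 : (galInt σ).comp (toCInt hϖ) = IsAdicComplete.liftRingHom J g hg := by
    refine IsAdicComplete.eq_liftRingHom J g hg _ fun n => RingHom.ext fun y => ?_
    change Ideal.Quotient.mk (J ^ n) (galInt σ (toCInt hϖ y)) = gq n (fam hϖ n y)
    rw [← mk_toCInt hϖ n y]
    rfl
  have h2 : (toCInt hϖ).comp (maxUnramifiedCompletion.galAut F σ).toRingHom = IsAdicComplete.liftRingHom J g hg := by
    refine IsAdicComplete.eq_liftRingHom J g hg _ fun n => RingHom.ext fun y => ?_
    change Ideal.Quotient.mk (J ^ n) (toCInt hϖ (maxUnramifiedCompletion.galAut F σ y)) = gq n (fam hϖ n y)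
    rw [mk_toCInt hϖ n, fam_apply, fam_apply, maxUnramifiedCompletion.evalₐ_galAut]
    generalize evalₐ (maximalIdeal (maxUnramifiedIntegers F)) n y = q
    induction q using Quotient.inductionOn' with
    | h r =>
      change Ideal.Quotient.mk (J ^ n) (ofMaxUnramifiedIntegers F (σ • r)) =
        Ideal.Quotient.mk (J ^ n) (galInt σ (ofMaxUnramifiedIntegers F r))
      rw [galInt_ofMaxUnramifiedIntegers]
  have := congrArg (fun f : maxUnramifiedCompletion F →+* integerC F => f x) (h1.trans h2.symm)
  exact this

end Uniformizer

/-! ### The embedding `ι : 𝒪̂_{F_nr} → ℂ_F` (choice-free statement) -/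

/-- A uniformiser of `𝒪_F` exists. [folklore] -/
theorem exists_irreducible_integer : ∃ ϖ : 𝒪[F], Irreducible ϖ :=
  IsDiscreteValuationRing.exists_irreducible 𝒪[F]

variable (F) in
/-- **`ι : 𝒪̂_{F_nr} →+* ℂ_F`**, the canonical `Γ_F`-equivariant embedding of the completed maximal
unramified integers into `ℂ_F` (for a chosen uniformiser; the map does not depend on the choice,
being determined by its values on the dense subring `𝒪_{F_nr}`). [cite: SerreLocalFields1979, Ch. II §5]
[cite: FontaineOuyang2022, §3.1] -/
def maxUnramifiedCompletion.toC : maxUnramifiedCompletion F →+* CompletedAlgClosure F :=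
  (integerC F).subtype.comp (toCInt (exists_irreducible_integer (F := F)).choose_spec)

/-- `‖ι x‖ ≤ 1`. [folklore] -/
theorem norm_toC_le_one (x : maxUnramifiedCompletion F) : ‖maxUnramifiedCompletion.toC F x‖ ≤ 1 :=
  (toCInt _ x).2

/-- **`ι` extends `𝒪_{F_nr} ⊆ F̄ ⊆ ℂ_F`.** [cite: SerreLocalFields1979, Ch. II §5] -/
theorem toC_algebraMap' (b : maxUnramifiedIntegers F) :
    maxUnramifiedCompletion.toC F (algebraMap (maxUnramifiedIntegers F) (maxUnramifiedCompletion F) b) =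
      algClosureToC F (b : AlgebraicClosure F) := by
  change ((toCInt _ (algebraMap _ _ b) : integerC F) : CompletedAlgClosure F) = _
  rw [toCInt_algebraMap']; rfl

/-- **`ι` extends `𝒪_F → F → ℂ_F`** (hypothesis `hιa` of `PeriodRingData.isAdmissible_of_unramified`).
[cite: SerreLocalFields1979, Ch. II §5] -/
theorem toC_algebraMap (a : 𝒪[F]) :
    maxUnramifiedCompletion.toC F (algebraMap 𝒪[F] (maxUnramifiedCompletion F) a) =
      algebraMap F (CompletedAlgClosure F) (a : F) := by
  rw [maxUnramifiedCompletion.algebraMap_eq, toC_algebraMap', coe_algebraMap_maxUnramifiedIntegers,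
    IsScalarTower.algebraMap_apply 𝒪[F] F (AlgebraicClosure F), algClosureToC_algebraMap]
  rfl

/-- **`ι` is `Γ_F`-equivariant** (hypothesis `hισ` of `PeriodRingData.isAdmissible_of_unramified`).
[cite: SerreLocalFields1979, Ch. II §5] -/
theorem smul_toC (σ : absoluteGaloisGroup F) (x : maxUnramifiedCompletion F) :
    σ • maxUnramifiedCompletion.toC F x = maxUnramifiedCompletion.toC F (maxUnramifiedCompletion.galAut F σ x) := by
  change σ • ((toCInt _ x : integerC F) : CompletedAlgClosure F) = ((toCInt _ (maxUnramifiedCompletion.galAut F σ x) : integerC F) : CompletedAlgClosure F)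
  rw [← coe_galInt, galInt_toCInt]

end Literature.NumberTheory.PAdicHodge

end
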